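import Summits.HodgeConjecture.HodgeConjecture.Theorems.K2E1SphericalHeckeEigenSectionU2   -- ★ p858708 FILE A: `borelHeight_eq_one_of_mem`, `inv_mem_of_mem`, `borelHeight_coe_pos`, `continuous_borelHeight_coe`
import Literature.NumberTheory.Automorphic.UnitaryGroupIwasawaIntegration                  -- ★ `isCompact_comap_adelicVal_standardMaximalCompactGL`
import Literature.NumberTheory.Automorphic.UnitaryGroupTruncatedTraceClassElliptic         -- ★ `t2Space_quasiSplitAdelic`, `locallyCompactSpace_quasiSplitAdelic`, `secondCountableTopology_quasiSplitAdelic`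
import HarnessLib

/-!
# A good spherical test function: for every `z₀` there is a bi-`K_U`-invariant `h ∈ C_c(G(𝔸_F))`, `h ≥ 0`,
# with `ĥ(z₀) = ∫ h(x) H(x)^{z₀} dμ(x) ≠ 0`

(Langlands, *On the Functional Equations Satisfied by Eisenstein Series*, LNM 544 (1976), §6 p. 167: the operator
`δ(f)` may be chosen with `f̂ ≠ 0` at a given parameter; Mœglin–Waldspurger (1995), II.1.2; Bernstein–Lapid, «HC-lemma»
in the spherical case.)

Topic `NumberTheory/Automorphic`; crux H413, cell `pub/hodgecm-mathlib`, campaign «EIS-R7-BL-SPH-2», road card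
`ROADCARD-BL-SPH-3` §1 (P5)(c), companion of ★ `K2E1SphericalHeckeEigenSectionU2` ((a) `ĥ` entire, (b) `δ(h)f_z = ĥ(z)f_z`).
THEOREMS ONLY over accepted tree modules (no definition, no named fact, no instance, no notation, no `sorry`).

* §1 THE DOUBLE `K`-AVERAGE, for ANY topological group `G` (second countable, locally compact, Hausdorff), any compact
  subgroup `K ≤ G` with a Haar measure `μ_K` on `↥K`, and any `η : G → ℝ`: the function
  `h(x) = ∫_{K × K} η(k₁⁻¹ x k₂) d(μ_K ⊗ μ_K)` (spelled out, no definition) is continuous for `η` continuous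
  (`continuous_doubleAverage`), bi-`K`-invariant from LEFT-invariance of `μ_K ⊗ μ_K` alone (`doubleAverage_mul_left`,
  `doubleAverage_mul_right`), `≥ 0` for `η ≥ 0`, vanishes off the compact `K · tsupport η · K`
  (`hasCompactSupport_doubleAverage`), and is `> 0` at `1` when `η ≥ 0` is continuous with `η(1) ≠ 0` (`doubleAverage_one_pos`).
* §2 THE REAL PART OF `t^z`: `((t : ℂ)^z).re = t^{Re z} · cos(Im z · log t)` for `t > 0` (`re_ofReal_cpow_of_pos`).
* §3 THE TUBE: on `U(J_N)(𝔸_F)` with `K = K_U`, for every `z₀` there is `U ∈ 𝓝 1` with `|Im z₀ · log H(k u)| < 1` for all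
  `k ∈ K_U`, `u ∈ U` (`exists_nhds_forall_abs_mul_log_borelHeight_lt`; `H ≡ 1` on `K_U`, ★ `compact_open_separated_mul_right`).
* §4 **`exists_biInvariant_continuous_hasCompactSupport_integral_ne_zero`** — (P5)(c): for `μ` finite on compacta and
  positive on opens (e.g. Haar) and every `z₀ : ℂ` there is `h : G(𝔸_F) → ℝ`, continuous, compactly supported, `≥ 0`,
  with `h(k₁ x k₂) = h(x)` (`k₁, k₂ ∈ K_U`) and `Re ĥ(z₀) > 0`, in particular `ĥ(z₀) ≠ 0`; plus the `ℂ`-valued packaging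
  `exists_test_function_cm`-style corollary `exists_leftInvariant_complex_testFunction` in the letters of FILE A (b).

## References
* R. P. Langlands, *On the Functional Equations Satisfied by Eisenstein Series*, LNM 544 (1976), §6 [Langlands1976].
* C. Mœglin, J.-L. Waldspurger, *Spectral Decomposition and Eisenstein Series*, CUP (1995), II.1 [MoeglinWaldspurger1995].
-/

set_option autoImplicit false
set_option linter.dupNamespace false

noncomputable section

open MeasureTheory Measure NumberField IsDedekindDomain Set Filter Matrix Metric Complex Topology
open scoped ENNReal NNReal MatrixGroups Pointwise
open Literature.NumberTheory Literature.NumberTheory.Automorphic Literature.NumberTheory.Automorphic.UnitaryGroup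
open AdelicGroupData
open Summit.HodgeConjecture.HodgeConjecture.Cruxes.H413.K2E1SphericalHeckeEigenSectionU2
open Summit.HodgeConjecture.HodgeConjecture.Cruxes.H413.K2E1HeightFunctionU3 (borelHeight_one)

namespace Summit.HodgeConjecture.HodgeConjecture.Cruxes.H413.K2E1SphericalHeckeGoodTestFunctionU2

/-! ## §1 The double `K`-average `h(x) = ∫_{K×K} η(k₁⁻¹ x k₂)` on a topological group -/

section DoubleAverage

variable {G : Type*} [Group G]

/-- The integrand `(x, (k₁, k₂)) ↦ η(k₁⁻¹ x k₂)` is jointly continuous for `η` continuous. [folklore] -/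
theorem continuous_doubleAverage_integrand [TopologicalSpace G] [IsTopologicalGroup G] (K : Subgroup G) {η : G → ℝ}
    (hη : Continuous η) :
    Continuous fun q : G × (K × K) => η (((q.2.1 : K) : G)⁻¹ * q.1 * ((q.2.2 : K) : G)) :=
  hη.comp ((((continuous_subtype_val.comp (continuous_fst.comp continuous_snd)).inv).mul continuous_fst).mul
    (continuous_subtype_val.comp (continuous_snd.comp continuous_snd)))

/-- `h ≥ 0` for `η ≥ 0`. [folklore] -/
theorem doubleAverage_nonneg [MeasurableSpace G] (K : Subgroup G) (μK : Measure K) {η : G → ℝ} (hη : ∀ y, 0 ≤ η y)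
    (x : G) :
    0 ≤ ∫ p : K × K, η (((p.1 : K) : G)⁻¹ * x * ((p.2 : K) : G)) ∂(μK.prod μK) :=
  integral_nonneg fun _ => hη _

/-- If `η(k₁⁻¹ x k₂) = 0` for all `k₁, k₂ ∈ K` then `h(x) = 0`. [folklore] -/
theorem doubleAverage_eq_zero [MeasurableSpace G] (K : Subgroup G) (μK : Measure K) (η : G → ℝ) {x : G}
    (h0 : ∀ k₁ ∈ K, ∀ k₂ ∈ K, η (k₁⁻¹ * x * k₂) = 0) :
    (∫ p : K × K, η (((p.1 : K) : G)⁻¹ * x * ((p.2 : K) : G)) ∂(μK.prod μK)) = 0 := by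
  have h1 : (fun p : K × K => η (((p.1 : K) : G)⁻¹ * x * ((p.2 : K) : G))) = fun _ => 0 :=
    funext fun p => h0 _ p.1.2 _ p.2.2
  rw [h1, integral_zero]

/-- If `h(x) ≠ 0` then `η(k₁⁻¹ x k₂) ≠ 0` for some `k₁, k₂ ∈ K`. [folklore] -/
theorem exists_ne_zero_of_doubleAverage_ne_zero [MeasurableSpace G] (K : Subgroup G) (μK : Measure K) (η : G → ℝ)
    {x : G} (hx : (∫ p : K × K, η (((p.1 : K) : G)⁻¹ * x * ((p.2 : K) : G)) ∂(μK.prod μK)) ≠ 0) :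
    ∃ k₁ ∈ K, ∃ k₂ ∈ K, η (k₁⁻¹ * x * k₂) ≠ 0 := by
  by_contra h
  push Not at h
  exact hx (doubleAverage_eq_zero K μK η h)

/-- **Compact support of the double average.** If `η` has compact support then `h` vanishes off the compact set
`K · tsupport η · K⁻¹ (= K · tsupport η · K)`, hence has compact support. [folklore] -/
theorem hasCompactSupport_doubleAverage [TopologicalSpace G] [IsTopologicalGroup G] [T2Space G] [MeasurableSpace G]
    (K : Subgroup G) (hK : IsCompact (K : Set G)) (μK : Measure K) {η : G → ℝ} (hηs : HasCompactSupport η) :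
    HasCompactSupport fun x : G => ∫ p : K × K, η (((p.1 : K) : G)⁻¹ * x * ((p.2 : K) : G)) ∂(μK.prod μK) := by
  refine HasCompactSupport.intro ((hK.prod (hηs.prod hK)).image
    (show Continuous fun q : G × (G × G) => q.1 * q.2.1 * q.2.2⁻¹ from
      (continuous_fst.mul (continuous_fst.comp continuous_snd)).mul (continuous_snd.comp continuous_snd).inv)) ?_
  intro x hx
  refine doubleAverage_eq_zero K μK η fun k₁ hk₁ k₂ hk₂ => ?_
  by_contra hne
  refine hx ⟨(k₁, (k₁⁻¹ * x * k₂, k₂)), ⟨hk₁, subset_tsupport _ (Function.mem_support.2 hne), hk₂⟩, ?_⟩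
  simp only [mul_assoc, mul_inv_cancel, mul_one, mul_inv_cancel_left]

variable [TopologicalSpace G] [IsTopologicalGroup G] [MeasurableSpace G] [BorelSpace G] [SecondCountableTopology G]
variable (K : Subgroup G) (μK : Measure K) (η : G → ℝ)

/-- **Continuity of the double average.** For `K` compact, `μ_K` a Haar measure on `↥K` and `η` continuous,
`x ↦ ∫_{K×K} η(k₁⁻¹ x k₂) d(μ_K ⊗ μ_K)` is continuous (parametric integral of a jointly continuous integrand over a
compact space). [folklore] -/
theorem continuous_doubleAverage [LocallyCompactSpace G] (hK : IsCompact (K : Set G)) [μK.IsHaarMeasure]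
    (hη : Continuous η) :
    Continuous fun x : G => ∫ p : K × K, η (((p.1 : K) : G)⁻¹ * x * ((p.2 : K) : G)) ∂(μK.prod μK) := by
  haveI : CompactSpace K := isCompact_iff_compactSpace.mp hK
  have h := continuous_parametric_integral_of_continuous (μ := μK.prod μK)
    (f := fun (x : G) (p : K × K) => η (((p.1 : K) : G)⁻¹ * x * ((p.2 : K) : G)))
    (continuous_doubleAverage_integrand K hη) isCompact_univ
  simpa only [Measure.restrict_univ] using h

/-- Left `K`-invariance: `h(κ x) = h(x)` for `κ ∈ K` (substitute `k₁ ↦ κ k₁`, left-invariance of `μ_K ⊗ μ_K`).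
[folklore] -/
theorem doubleAverage_mul_left [μK.IsMulLeftInvariant] [SFinite μK] (κ : K) (x : G) :
    (∫ p : K × K, η (((p.1 : K) : G)⁻¹ * ((κ : G) * x) * ((p.2 : K) : G)) ∂(μK.prod μK)) =
      ∫ p : K × K, η (((p.1 : K) : G)⁻¹ * x * ((p.2 : K) : G)) ∂(μK.prod μK) := by
  have h1 : (fun p : K × K => η (((p.1 : K) : G)⁻¹ * ((κ : G) * x) * ((p.2 : K) : G))) =
      fun p : K × K => (fun q : K × K => η (((q.1 : K) : G)⁻¹ * x * ((q.2 : K) : G))) ((κ⁻¹, (1 : K)) * p) := by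
    funext p
    simp only [Prod.fst_mul, Prod.snd_mul, one_mul, Subgroup.coe_mul, Subgroup.coe_inv, _root_.mul_inv_rev, inv_inv,
      mul_assoc]
  rw [h1]
  exact integral_mul_left_eq_self (μ := μK.prod μK)
    (fun q : K × K => η (((q.1 : K) : G)⁻¹ * x * ((q.2 : K) : G))) ((κ⁻¹, (1 : K)))

/-- Right `K`-invariance: `h(x κ) = h(x)` for `κ ∈ K` (substitute `k₂ ↦ κ⁻¹ k₂`). [folklore] -/
theorem doubleAverage_mul_right [μK.IsMulLeftInvariant] [SFinite μK] (κ : K) (x : G) :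
    (∫ p : K × K, η (((p.1 : K) : G)⁻¹ * (x * (κ : G)) * ((p.2 : K) : G)) ∂(μK.prod μK)) =
      ∫ p : K × K, η (((p.1 : K) : G)⁻¹ * x * ((p.2 : K) : G)) ∂(μK.prod μK) := by
  have h1 : (fun p : K × K => η (((p.1 : K) : G)⁻¹ * (x * (κ : G)) * ((p.2 : K) : G))) =
      fun p : K × K => (fun q : K × K => η (((q.1 : K) : G)⁻¹ * x * ((q.2 : K) : G))) (((1 : K), κ) * p) := by
    funext p
    simp only [Prod.fst_mul, Prod.snd_mul, one_mul, Subgroup.coe_mul, mul_assoc]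
  rw [h1]
  exact integral_mul_left_eq_self (μ := μK.prod μK)
    (fun q : K × K => η (((q.1 : K) : G)⁻¹ * x * ((q.2 : K) : G))) (((1 : K), κ))

/-- Bi-`K`-invariance `h(k₁ x k₂) = h(x)` for `k₁, k₂ ∈ K`. [folklore] -/
theorem doubleAverage_mul_mul [μK.IsMulLeftInvariant] [SFinite μK] {k₁ k₂ : G} (hk₁ : k₁ ∈ K) (hk₂ : k₂ ∈ K)
    (x : G) :
    (∫ p : K × K, η (((p.1 : K) : G)⁻¹ * (k₁ * x * k₂) * ((p.2 : K) : G)) ∂(μK.prod μK)) =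
      ∫ p : K × K, η (((p.1 : K) : G)⁻¹ * x * ((p.2 : K) : G)) ∂(μK.prod μK) := by
  rw [show k₁ * x * k₂ = ((⟨k₁, hk₁⟩ : K) : G) * (x * ((⟨k₂, hk₂⟩ : K) : G)) from mul_assoc _ _ _,
    doubleAverage_mul_left K μK η ⟨k₁, hk₁⟩, doubleAverage_mul_right K μK η ⟨k₂, hk₂⟩]

/-- **Positivity at the identity.** For `K` compact, `μ_K` Haar on `↥K`, `η ≥ 0` continuous with `η(1) ≠ 0`:
`h(1) > 0`. [folklore] -/
theorem doubleAverage_one_pos (hK : IsCompact (K : Set G)) [μK.IsHaarMeasure] (hη : Continuous η)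
    (hη0 : ∀ y, 0 ≤ η y) (hη1 : η 1 ≠ 0) :
    0 < ∫ p : K × K, η (((p.1 : K) : G)⁻¹ * 1 * ((p.2 : K) : G)) ∂(μK.prod μK) := by
  haveI : CompactSpace K := isCompact_iff_compactSpace.mp hK
  have hc : Continuous fun p : K × K => η (((p.1 : K) : G)⁻¹ * 1 * ((p.2 : K) : G)) :=
    (continuous_doubleAverage_integrand K hη).comp (Continuous.prodMk continuous_const continuous_id)
  refine hc.integral_pos_of_hasCompactSupport_nonneg_nonzero (HasCompactSupport.of_compactSpace _)
    (fun p => hη0 _) (x := ((1 : K), (1 : K))) ?_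
  simpa only [Subgroup.coe_one, inv_one, mul_one] using hη1

end DoubleAverage

/-! ## §2 The real part of `t^z` for `t > 0` -/

/-- `((t : ℂ)^z).re = t^{Re z} · cos(Im z · log t)` for `t > 0`. [folklore] -/
theorem re_ofReal_cpow_of_pos {t : ℝ} (ht : 0 < t) (z : ℂ) :
    (((t : ℝ) : ℂ) ^ z).re = t ^ z.re * Real.cos (z.im * Real.log t) := by
  rw [cpow_def_of_ne_zero (ofReal_ne_zero.2 ht.ne'), ← ofReal_log ht.le, exp_re, Real.rpow_def_of_pos ht,
    re_ofReal_mul, im_ofReal_mul, mul_comm (Real.log t) z.im]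

/-- If `|Im z · log t| ≤ 1` then `cos(Im z · log t) > 0` (`1 < π/2`). [folklore] -/
theorem cos_pos_of_abs_le_one {θ : ℝ} (hθ : |θ| ≤ 1) : 0 < Real.cos θ := by
  have hπ : (1 : ℝ) < Real.pi / 2 := by linarith [Real.pi_gt_three]
  exact Real.cos_pos_of_mem_Ioo ⟨by linarith [(abs_le.1 hθ).1], by linarith [(abs_le.1 hθ).2]⟩

/-! ## §3 The tube around `K_U` on which `|Im z₀ · log H| < 1` -/

section Tube

variable {F E : Type} [Field F] [NumberField F] [Field E] [NumberField E] [Algebra F E] {c : E ≃ₐ[F] E}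
variable {N : ℕ} [NeZero N]

/-- `x ↦ Im z₀ · log H(x)` is continuous (`H > 0` continuous). [folklore] -/
theorem continuous_mul_log_borelHeight (z₀ : ℂ) :
    Continuous fun x : (quasiSplit F E c N).Adelic => z₀.im * Real.log ((borelHeight x : ℝ≥0) : ℝ) :=
  continuous_const.mul (continuous_borelHeight_coe.log fun x => (borelHeight_coe_pos x).ne')

/-- **The tube.** For every `z₀ : ℂ` there is a neighbourhood `U` of `1` in `G(𝔸_F)` such that
`|Im z₀ · log H(k u)| < 1` for all `k ∈ K_U`, `u ∈ U`: the open set `{|Im z₀ · log H| < 1}` contains the compact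
`K_U` (`H ≡ 1` there), so it contains `K_U · U` for some `U ∈ 𝓝 1` (★ `compact_open_separated_mul_right`). [folklore] -/
theorem exists_nhds_forall_abs_mul_log_borelHeight_lt (z₀ : ℂ) :
    ∃ U ∈ 𝓝 (1 : (quasiSplit F E c N).Adelic), ∀ k : (quasiSplit F E c N).Adelic,
      adelicVal F E c N ((StdForm.antidiagonal N).over E) k ∈ standardMaximalCompactGL N E →
        ∀ u ∈ U, |z₀.im * Real.log ((borelHeight (k * u) : ℝ≥0) : ℝ)| < 1 := by
  set V : Set (quasiSplit F E c N).Adelic := {x | |z₀.im * Real.log ((borelHeight x : ℝ≥0) : ℝ)| < 1} with hV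
  have hVo : IsOpen V := isOpen_lt (continuous_mul_log_borelHeight z₀).abs continuous_const
  have hKV : (((standardMaximalCompactGL N E).comap (adelicVal F E c N ((StdForm.antidiagonal N).over E)) :
      Subgroup (quasiSplit F E c N).Adelic) : Set (quasiSplit F E c N).Adelic) ⊆ V := by
    intro k hk
    simp only [hV, mem_setOf_eq, borelHeight_eq_one_of_mem (Subgroup.mem_comap.1 hk), NNReal.coe_one, Real.log_one,
      mul_zero, abs_zero, zero_lt_one]
  obtain ⟨U, hU, hKU⟩ := compact_open_separated_mul_right isCompact_comap_adelicVal_standardMaximalCompactGL hVo hKV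
  refine ⟨U, hU, fun k hk u hu => ?_⟩
  have hmem : k * u ∈ V := hKU (Set.mul_mem_mul (Subgroup.mem_comap.2 hk) hu)
  simpa only [hV, mem_setOf_eq] using hmem

end Tube

/-! ## §4 (P5)(c): the good bi-`K_U`-invariant test function -/

section Good

variable {F E : Type} [Field F] [NumberField F] [Field E] [NumberField E] [Algebra F E] {c : E ≃ₐ[F] E}
variable {N : ℕ} [NeZero N]
variable [MeasurableSpace (quasiSplit F E c N).Adelic] [BorelSpace (quasiSplit F E c N).Adelic]

/-- **(P5)(c) A good spherical test function.** Let `μ` be a measure on `G(𝔸_F) = U(J_N)(𝔸_F)` finite on compacta and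
positive on non-empty open sets (e.g. a Haar measure) and `z₀ : ℂ`. There is `h : G(𝔸_F) → ℝ`, continuous, of compact
support, `h ≥ 0`, bi-`K_U`-invariant (`h(k₁ x k₂) = h(x)` for `k₁, k₂ ∈ K_U`), with `Re ĥ(z₀) = Re ∫ h(x) H(x)^{z₀} dμ(x) > 0`.
Construction: `h = ∫_{K_U×K_U} η(k₁⁻¹ · k₂)` for a Urysohn bump `η` at `1` supported in the tube of §3, so that
`Re H(x)^{z₀} = H(x)^{Re z₀} cos(Im z₀ log H(x)) > 0` wherever `h(x) ≠ 0`. [cite: Langlands1976, §6 p. 167]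
[cite: MoeglinWaldspurger1995, II.1.2] -/
theorem exists_biInvariant_continuous_hasCompactSupport_re_integral_pos (μ : Measure (quasiSplit F E c N).Adelic)
    [IsFiniteMeasureOnCompacts μ] [μ.IsOpenPosMeasure] (z₀ : ℂ) :
    ∃ h : (quasiSplit F E c N).Adelic → ℝ, Continuous h ∧ HasCompactSupport h ∧ (∀ x, 0 ≤ h x) ∧
      (∀ k₁ k₂ : (quasiSplit F E c N).Adelic,
        adelicVal F E c N ((StdForm.antidiagonal N).over E) k₁ ∈ standardMaximalCompactGL N E →
        adelicVal F E c N ((StdForm.antidiagonal N).over E) k₂ ∈ standardMaximalCompactGL N E →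
          ∀ x, h (k₁ * x * k₂) = h x) ∧
      0 < (∫ x, (h x : ℂ) * (((borelHeight x : ℝ≥0) : ℝ) : ℂ) ^ z₀ ∂μ).re := by
  haveI := t2Space_quasiSplitAdelic (F := F) (E := E) (c := c) (N := N)
  haveI := locallyCompactSpace_quasiSplitAdelic (F := F) (E := E) (c := c) (N := N)
  haveI := secondCountableTopology_quasiSplitAdelic (F := F) (E := E) (c := c) (N := N)
  -- the compact subgroup `K_U` and a Haar measure on it
  set K : Subgroup (quasiSplit F E c N).Adelic :=
    (standardMaximalCompactGL N E).comap (adelicVal F E c N ((StdForm.antidiagonal N).over E)) with hKdef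
  have hKc : IsCompact (K : Set (quasiSplit F E c N).Adelic) := isCompact_comap_adelicVal_standardMaximalCompactGL
  haveI : CompactSpace K := isCompact_iff_compactSpace.mp hKc
  let μK : Measure K := Measure.haar
  -- the tube and the bump
  obtain ⟨U, hU, hKU⟩ := exists_nhds_forall_abs_mul_log_borelHeight_lt (F := F) (E := E) (c := c) (N := N) z₀
  obtain ⟨η, hη1, hη0, hηs, hη01⟩ := exists_continuous_one_zero_of_isCompact (isCompact_singleton (x := (1 : _)))
    (isOpen_interior (s := U)).isClosed_compl
    (disjoint_singleton_left.2 fun h1 => h1 (mem_interior_iff_mem_nhds.2 hU))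
  have hηc : Continuous (η : (quasiSplit F E c N).Adelic → ℝ) := η.continuous
  have hηnn : ∀ y, 0 ≤ η y := fun y => (hη01 y).1
  have hηU : ∀ y, η y ≠ 0 → y ∈ U := fun y hy => by
    by_contra hyU
    exact hy (hη0 (fun hy' => hyU (interior_subset hy')))
  -- the test function
  refine ⟨fun x => ∫ p : K × K, η (((p.1 : K) : (quasiSplit F E c N).Adelic)⁻¹ * x * ((p.2 : K) : _)) ∂(μK.prod μK),
    continuous_doubleAverage K μK η hKc hηc, hasCompactSupport_doubleAverage K hKc μK hηs,
    doubleAverage_nonneg K μK hηnn, fun k₁ k₂ hk₁ hk₂ x =>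
      doubleAverage_mul_mul K μK η (Subgroup.mem_comap.2 hk₁) (Subgroup.mem_comap.2 hk₂) x, ?_⟩
  -- `Re ĥ(z₀) = ∫ h(x) H(x)^{Re z₀} cos(Im z₀ log H(x)) dμ > 0`
  set h : (quasiSplit F E c N).Adelic → ℝ :=
    fun x => ∫ p : K × K, η (((p.1 : K) : (quasiSplit F E c N).Adelic)⁻¹ * x * ((p.2 : K) : _)) ∂(μK.prod μK) with hh
  have hhc : Continuous h := continuous_doubleAverage K μK η hKc hηc
  have hhs : HasCompactSupport h := hasCompactSupport_doubleAverage K hKc μK hηs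
  have hhnn : ∀ x, 0 ≤ h x := doubleAverage_nonneg K μK hηnn
  -- wherever `h ≠ 0`, `|Im z₀ log H| < 1`
  have htube : ∀ x, h x ≠ 0 → |z₀.im * Real.log ((borelHeight x : ℝ≥0) : ℝ)| < 1 := by
    intro x hx
    obtain ⟨k₁, hk₁, k₂, hk₂, hne⟩ := exists_ne_zero_of_doubleAverage_ne_zero K μK η hx
    have hy : k₁⁻¹ * x * k₂ ∈ U := hηU _ hne
    have hH : borelHeight x = borelHeight (k₁ * (k₁⁻¹ * x * k₂)) := by
      rw [show k₁ * (k₁⁻¹ * x * k₂) = x * k₂ by simp only [mul_assoc, mul_inv_cancel_left],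
        borelHeight_mul_of_mem_comap_standardMaximalCompactGL hk₂ x]
    rw [hH]
    exact hKU k₁ (Subgroup.mem_comap.1 hk₁) _ hy
  -- the real integrand
  set g : (quasiSplit F E c N).Adelic → ℝ := fun x =>
    h x * ((((borelHeight x : ℝ≥0) : ℝ) ^ z₀.re) * Real.cos (z₀.im * Real.log ((borelHeight x : ℝ≥0) : ℝ))) with hg
  have hgc : Continuous g :=
    hhc.mul ((continuous_borelHeight_coe.rpow_const fun x => Or.inl (borelHeight_coe_pos x).ne').mul
      (Real.continuous_cos.comp (continuous_mul_log_borelHeight z₀)))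
  have hgs : HasCompactSupport g := hhs.mul_right
  have hgnn : ∀ x, 0 ≤ g x := by
    intro x
    by_cases hx : h x = 0
    · simp only [hg, hx, zero_mul, le_refl]
    · exact mul_nonneg (hhnn x) (mul_nonneg (Real.rpow_nonneg (borelHeight_coe_pos x).le _)
        (cos_pos_of_abs_le_one (htube x hx).le).le)
  have hg1 : g 1 ≠ 0 := by
    have h1 : 0 < h 1 := doubleAverage_one_pos K μK η hKc hηc hηnn (by rw [hη1 rfl]; exact one_ne_zero)
    simp only [hg, borelHeight_one, NNReal.coe_one, Real.one_rpow, Real.log_one, mul_zero, Real.cos_zero, mul_one]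
    exact h1.ne'
  have hpos : 0 < ∫ x, g x ∂μ := hgc.integral_pos_of_hasCompactSupport_nonneg_nonzero hgs hgnn hg1
  -- identify `Re ĥ(z₀)` with `∫ g`
  have hint : Integrable (fun x => (h x : ℂ) * (((borelHeight x : ℝ≥0) : ℝ) : ℂ) ^ z₀) μ :=
    (continuous_mul_borelHeight_cpow (continuous_ofReal.comp hhc) z₀).integrable_of_hasCompactSupport
      ((hhs.comp_left ofReal_zero).mul_right)
  have hre : (∫ x, (h x : ℂ) * (((borelHeight x : ℝ≥0) : ℝ) : ℂ) ^ z₀ ∂μ).re = ∫ x, g x ∂μ := by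
    rw [← RCLike.re_to_complex, ← integral_re hint]
    refine integral_congr_ae (Eventually.of_forall fun x => ?_)
    simp only [RCLike.re_to_complex, re_ofReal_mul, re_ofReal_cpow_of_pos (borelHeight_coe_pos x), hg]
  rw [hre]
  exact hpos

/-- (P5)(c), short form: a continuous, compactly supported, non-negative, bi-`K_U`-invariant `h` with `ĥ(z₀) ≠ 0`.
[cite: Langlands1976, §6 p. 167] -/
theorem exists_biInvariant_continuous_hasCompactSupport_integral_ne_zero (μ : Measure (quasiSplit F E c N).Adelic)
    [IsFiniteMeasureOnCompacts μ] [μ.IsOpenPosMeasure] (z₀ : ℂ) :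
    ∃ h : (quasiSplit F E c N).Adelic → ℝ, Continuous h ∧ HasCompactSupport h ∧ (∀ x, 0 ≤ h x) ∧
      (∀ k₁ k₂ : (quasiSplit F E c N).Adelic,
        adelicVal F E c N ((StdForm.antidiagonal N).over E) k₁ ∈ standardMaximalCompactGL N E →
        adelicVal F E c N ((StdForm.antidiagonal N).over E) k₂ ∈ standardMaximalCompactGL N E →
          ∀ x, h (k₁ * x * k₂) = h x) ∧
      (∫ x, (h x : ℂ) * (((borelHeight x : ℝ≥0) : ℝ) : ℂ) ^ z₀ ∂μ) ≠ 0 := by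
  obtain ⟨h, hc, hs, hnn, hK, hre⟩ :=
    exists_biInvariant_continuous_hasCompactSupport_re_integral_pos (F := F) (E := E) (c := c) (N := N) μ z₀
  exact ⟨h, hc, hs, hnn, hK, fun h0 => hre.ne' (by rw [h0, zero_re])⟩

/-- (P5)(c) in the letters of FILE A (b): a `ℂ`-valued, continuous, compactly supported, LEFT-`K_U`-invariant test
function `h` (also right-invariant and with non-negative real values) with `ĥ(z₀) = ∫ h(x) H(x)^{z₀} dμ(x) ≠ 0` — so that
★ `integral_flatSectionU_mul_mul_eq` gives `δ(h) f_{z₀} = ĥ(z₀) f_{z₀}` with `ĥ(z₀) ≠ 0`. [cite: Langlands1976, §6 p. 167] -/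
theorem exists_complex_testFunction_integral_ne_zero (μ : Measure (quasiSplit F E c N).Adelic)
    [IsFiniteMeasureOnCompacts μ] [μ.IsOpenPosMeasure] (z₀ : ℂ) :
    ∃ h : (quasiSplit F E c N).Adelic → ℂ, Continuous h ∧ HasCompactSupport h ∧ (∀ x, 0 ≤ (h x).re ∧ (h x).im = 0) ∧
      (∀ k : (quasiSplit F E c N).Adelic,
        adelicVal F E c N ((StdForm.antidiagonal N).over E) k ∈ standardMaximalCompactGL N E → ∀ x, h (k * x) = h x) ∧
      (∀ k : (quasiSplit F E c N).Adelic,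
        adelicVal F E c N ((StdForm.antidiagonal N).over E) k ∈ standardMaximalCompactGL N E → ∀ x, h (x * k) = h x) ∧
      (∫ x, h x * (((borelHeight x : ℝ≥0) : ℝ) : ℂ) ^ z₀ ∂μ) ≠ 0 := by
  obtain ⟨h, hc, hs, hnn, hK, hne⟩ :=
    exists_biInvariant_continuous_hasCompactSupport_integral_ne_zero (F := F) (E := E) (c := c) (N := N) μ z₀
  have h1 : adelicVal F E c N ((StdForm.antidiagonal N).over E) 1 ∈ standardMaximalCompactGL N E := by
    rw [map_one]; exact one_mem _
  refine ⟨fun x => (h x : ℂ), continuous_ofReal.comp hc, hs.comp_left ofReal_zero,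
    fun x => ⟨by simpa only [ofReal_re] using hnn x, ofReal_im _⟩, fun k hk x => ?_, fun k hk x => ?_, hne⟩
  · simpa only [mul_one] using congrArg (fun r : ℝ => (r : ℂ)) (hK k 1 hk h1 x)
  · simpa only [one_mul] using congrArg (fun r : ℝ => (r : ℂ)) (hK 1 k h1 hk x)

end Good

end Summit.HodgeConjecture.HodgeConjecture.Cruxes.H413.K2E1SphericalHeckeGoodTestFunctionU2

end
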